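import Literature.Probability.LatticeModels.SlitPlaneSeamMatching
import HarnessLib

/-!
# Kesten's bound for the explicit full-plane spinor: `|F_{[ℂ_δ,a]}(e)| ≤ C · dist(e, a)^{-1/2}`

Topic `Literature/Probability/LatticeModels`. Chelkak–Hongler–Izyurov 2015, Lemma 3.3 / (3.3):
`hm ≤ C δ^{1/2} |z - a|^{-1/2}` (H. Kesten 1987), for the closed-form kernel of the tree
(`abs_slitKernel_le : |K(k, s)| ≤ 8/√(1 + |k| + s)`, `SlitPlaneKernelBounds.lean`), transported to the
bond function `slitFC p₀` of `SlitPlaneSpinorCorners.lean` (and its gauged version `slitFCg`):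

* `norm_kcVec` (`‖kcVec v₀ n a d‖ = √(a² + d²)`), `norm_slitFup_le`, `norm_slitFdn_le`, `norm_slitFsh_le`
  (`≤ 12/√(1 + |k| + |s|)`);
* **`norm_slitFC_east_le`**, **`norm_slitFC_north_le`**: `‖slitFC p₀ e‖ ≤ 60/√(1 + |srcDX| + |srcDY|)`
  at the bond `e` based at the site with offsets `srcDX`, `srcDY` from `p₀`; `norm_slitFCg_eq`.

Everything is proved; no named fact.

## References

* D. Chelkak, C. Hongler, K. Izyurov, Ann. of Math. 181 (2015), Lemma 3.3 (3.3)
  [ChelkakHonglerIzyurovAnnals2015].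
* H. Kesten, Stoch. Proc. Appl. 25 (1987) 165–184 [Kesten1987].
-/

noncomputable section

namespace Literature.Probability.LatticeModels

open Complex

/-- **The norm of the bond value**: `‖kcVec v₀ n a d‖ = √(a² + d²)`. [cite: ChelkakHonglerIzyurov2021, Remark 2.11] -/
theorem norm_kcVec (v₀ : Site 2) (n : ℕ) (a d : ℝ) : ‖kcVec v₀ n a d‖ = Real.sqrt (a ^ 2 + d ^ 2) := by
  have hN := frameNorm_pos v₀ n
  rw [kcVec, norm_div, norm_mul, Complex.norm_real, Real.norm_eq_abs, abs_of_pos hN]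
  rw [show ‖frameVec v₀ * (1 - I) ^ n‖ = frameNorm v₀ n from rfl, mul_div_assoc, div_self hN.ne', mul_one]
  rw [Complex.norm_def, Complex.normSq_apply]
  congr 1
  simp; ring

/-- `‖kcVec v₀ n a d‖ ≤ |a| + |d|`. [folklore] -/
theorem norm_kcVec_le (v₀ : Site 2) (n : ℕ) (a d : ℝ) : ‖kcVec v₀ n a d‖ ≤ |a| + |d| := by
  rw [norm_kcVec, Real.sqrt_le_left (by positivity)]
  nlinarith [abs_nonneg a, abs_nonneg d, sq_abs a, sq_abs d]

/-- `√(1 + |k| + |s|) ≤ √2 · √(1 + |k + 1| + |s|)` and the like: shifting `k` by one. [folklore] -/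
theorem sqrt_shift_le (x y : ℝ) (hx : 0 ≤ x) (hxy : x ≤ 2 * y) : 1 / Real.sqrt y ≤ Real.sqrt 2 / Real.sqrt x ∨ x = 0 := by
  rcases eq_or_lt_of_le hx with h | h
  · exact Or.inr h.symm
  · left
    have hy : 0 < y := by linarith
    rw [div_le_div_iff₀ (Real.sqrt_pos.2 hy) (Real.sqrt_pos.2 h), one_mul, ← Real.sqrt_mul (by norm_num)]
    exact Real.sqrt_le_sqrt (by linarith)

/-- **Kesten's bound for the upper sheet**: `‖slitFup k s‖ ≤ 12/√(1 + |k| + |s|)`. [cite: ChelkakHonglerIzyurovAnnals2015, Lemma 3.3 (3.3)] -/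
theorem norm_slitFup_le (k s : ℤ) : ‖slitFup k s‖ ≤ 12 / Real.sqrt (1 + |(k : ℝ)| + |(s : ℝ)|) := by
  have hpos : 0 < 1 + |(k : ℝ)| + |(s : ℝ)| := by positivity
  have hsabs : ((s.natAbs : ℕ) : ℝ) = |(s : ℝ)| := by
    rw [Nat.cast_natAbs, Int.cast_abs]
  unfold slitFup
  split_ifs with he
  · rw [Complex.norm_real, Real.norm_eq_abs]
    have h := abs_slitKernel_le k s.natAbs
    rw [hsabs] at h
    refine h.trans ?_
    exact div_le_div_of_nonneg_right (by norm_num) (Real.sqrt_pos.2 hpos).le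
  · rw [norm_mul, norm_mul, norm_neg, Complex.norm_I, one_mul, Complex.norm_real, Real.norm_eq_abs]
    have hsgn : ‖slitSgnUp s‖ = 1 := by unfold slitSgnUp; split_ifs <;> simp
    rw [hsgn, one_mul]
    have h := abs_slitKernel_le (-k - 1) s.natAbs
    rw [hsabs] at h
    refine h.trans ?_
    -- `1 + |k| + |s| ≤ 2 (1 + |-k-1| + |s|)`
    have hk : |(k : ℝ)| ≤ |(((-k - 1 : ℤ)) : ℝ)| + 1 := by
      push_cast
      have := abs_add_le (-(k : ℝ) - 1) 1
      rw [show -(k : ℝ) - 1 + 1 = -k by ring, abs_neg] at this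
      simpa using this
    have hpos' : 0 < 1 + |(((-k - 1 : ℤ)) : ℝ)| + |(s : ℝ)| := by positivity
    rw [div_le_div_iff₀ (Real.sqrt_pos.2 hpos') (Real.sqrt_pos.2 hpos)]
    have h2 : Real.sqrt (1 + |(k : ℝ)| + |(s : ℝ)|) ≤ Real.sqrt 2 * Real.sqrt (1 + |(((-k - 1 : ℤ)) : ℝ)| + |(s : ℝ)|) := by
      rw [← Real.sqrt_mul (by norm_num)]
      exact Real.sqrt_le_sqrt (by linarith [abs_nonneg ((((-k - 1 : ℤ)) : ℝ)), abs_nonneg ((s : ℤ) : ℝ)])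
    have hs2 : Real.sqrt 2 ≤ 3 / 2 := by
      rw [Real.sqrt_le_left (by norm_num)]; norm_num
    calc 8 * Real.sqrt (1 + |(k : ℝ)| + |(s : ℝ)|)
        ≤ 8 * (Real.sqrt 2 * Real.sqrt (1 + |(((-k - 1 : ℤ)) : ℝ)| + |(s : ℝ)|)) := by gcongr
      _ ≤ 12 * Real.sqrt (1 + |(((-k - 1 : ℤ)) : ℝ)| + |(s : ℝ)|) := by
          have := Real.sqrt_nonneg (1 + |(((-k - 1 : ℤ)) : ℝ)| + |(s : ℝ)|)
          nlinarith

/-- **Kesten's bound for the lower sheet.** [cite: ChelkakHonglerIzyurovAnnals2015, Lemma 3.3 (3.3)] -/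
theorem norm_slitFdn_le (k s : ℤ) : ‖slitFdn k s‖ ≤ 12 / Real.sqrt (1 + |(k : ℝ)| + |(s : ℝ)|) := by
  by_cases h : s ≠ 0 ∨ Even k ∨ 1 ≤ k
  · rw [← slitFup_eq_slitFdn h]; exact norm_slitFup_le k s
  · -- on the cut the two sheets are opposite
    push Not at h
    obtain ⟨hs, hk, -⟩ := h
    have hodd : ¬Even (k + s) := by rw [hs, add_zero]; exact hk
    have hup := norm_slitFup_le k s
    unfold slitFup at hup
    unfold slitFdn
    rw [if_neg hodd] at hup ⊢
    have e : ‖-I * slitSgnDn s * ((slitKernel (-k - 1) s.natAbs : ℝ) : ℂ)‖ = ‖-I * slitSgnUp s * ((slitKernel (-k - 1) s.natAbs : ℝ) : ℂ)‖ := by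
      simp only [norm_mul, norm_neg]
      congr 2
      unfold slitSgnDn slitSgnUp; split_ifs <;> simp
    rw [e]; exact hup

/-- The bound for the sheet used by a bond. [folklore] -/
theorem norm_slitFsh_le (σ k s : ℤ) : ‖slitFsh σ k s‖ ≤ 12 / Real.sqrt (1 + |(k : ℝ)| + |(s : ℝ)|) := by
  unfold slitFsh; split_ifs
  · exact norm_slitFup_le k s
  · exact norm_slitFdn_le k s

/-- Shifting `s` by one costs a factor `3/2`. [folklore] -/
theorem kesten_shift (X s : ℝ) : 12 / Real.sqrt (1 + |X| + |s - 1|) ≤ 18 / Real.sqrt (1 + |X| + |s|) ∧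
    12 / Real.sqrt (1 + |X| + |s + 1|) ≤ 18 / Real.sqrt (1 + |X| + |s|) := by
  have hpos : 0 < 1 + |X| + |s| := by positivity
  have hs2 : Real.sqrt 2 ≤ 3 / 2 := by rw [Real.sqrt_le_left (by norm_num)]; norm_num
  have key : ∀ t : ℝ, |s| ≤ |t| + 1 → 12 / Real.sqrt (1 + |X| + |t|) ≤ 18 / Real.sqrt (1 + |X| + |s|) := by
    intro t ht
    have hpos' : 0 < 1 + |X| + |t| := by positivity
    rw [div_le_div_iff₀ (Real.sqrt_pos.2 hpos') (Real.sqrt_pos.2 hpos)]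
    have h2 : Real.sqrt (1 + |X| + |s|) ≤ Real.sqrt 2 * Real.sqrt (1 + |X| + |t|) := by
      rw [← Real.sqrt_mul (by norm_num)]
      exact Real.sqrt_le_sqrt (by linarith [abs_nonneg X, abs_nonneg t])
    have := Real.sqrt_nonneg (1 + |X| + |t|)
    nlinarith
  refine ⟨key _ ?_, key _ ?_⟩
  · have := abs_add_le (s - 1) 1; rw [sub_add_cancel] at this; simpa using this
  · have := abs_add_le (s + 1) (-1); rw [add_neg_cancel_right] at this; simpa using this

/-- **Kesten's bound for the full-plane spinor on an east bond** (CHI (3.3) in the tree's frame):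
`‖slitFC p₀ {v, v + e₀}‖ ≤ 60/√(1 + |srcDX p₀ v| + |srcDY p₀ v|)`. [cite: ChelkakHonglerIzyurovAnnals2015, Lemma 3.3 (3.3)] -/
theorem norm_slitFC_east_le (p₀ v : Site 2) :
    ‖slitFC p₀ s(v, v + cornerUnit 0)‖ ≤ 60 / Real.sqrt (1 + |(srcDX p₀ v : ℝ)| + |(srcDY p₀ v : ℝ)|) := by
  rw [slitFC_east, slitFCH]
  refine (norm_kcVec_le _ _ _ _).trans ?_
  have h1 := (abs_re_le_norm _).trans (norm_slitFsh_le (srcDY p₀ v - 1) (-srcDX p₀ v) (srcDY p₀ v))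
  have h2 : |(-I * slitFsh (srcDY p₀ v - 1) (-srcDX p₀ v) (srcDY p₀ v - 1)).re| ≤
      12 / Real.sqrt (1 + |(((-srcDX p₀ v : ℤ)) : ℝ)| + |(((srcDY p₀ v - 1 : ℤ)) : ℝ)|) := by
    refine (abs_re_le_norm _).trans ?_
    rw [norm_mul, norm_neg, Complex.norm_I, one_mul]
    exact norm_slitFsh_le _ _ _
  push_cast at h1 h2
  rw [abs_neg] at h1 h2
  have h3 := (kesten_shift (srcDX p₀ v : ℝ) (srcDY p₀ v : ℝ)).1
  have hpos : 0 < 1 + |(srcDX p₀ v : ℝ)| + |(srcDY p₀ v : ℝ)| := by positivity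
  have h4 : 12 / Real.sqrt (1 + |(srcDX p₀ v : ℝ)| + |(srcDY p₀ v : ℝ)|) ≤ 18 / Real.sqrt (1 + |(srcDX p₀ v : ℝ)| + |(srcDY p₀ v : ℝ)|) :=
    div_le_div_of_nonneg_right (by norm_num) (Real.sqrt_pos.2 hpos).le
  calc |(slitFsh (srcDY p₀ v - 1) (-srcDX p₀ v) (srcDY p₀ v)).re| + |(-I * slitFsh (srcDY p₀ v - 1) (-srcDX p₀ v) (srcDY p₀ v - 1)).re|
      ≤ 18 / Real.sqrt (1 + |(srcDX p₀ v : ℝ)| + |(srcDY p₀ v : ℝ)|) + 18 / Real.sqrt (1 + |(srcDX p₀ v : ℝ)| + |(srcDY p₀ v : ℝ)|) :=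
        add_le_add (h1.trans h4) (h2.trans h3)
    _ ≤ 60 / Real.sqrt (1 + |(srcDX p₀ v : ℝ)| + |(srcDY p₀ v : ℝ)|) := by
        rw [← add_div]; exact div_le_div_of_nonneg_right (by norm_num) (Real.sqrt_pos.2 hpos).le

/-- **Kesten's bound for the full-plane spinor on a north bond.** [cite: ChelkakHonglerIzyurovAnnals2015, Lemma 3.3 (3.3)] -/
theorem norm_slitFC_north_le (p₀ x : Site 2) :
    ‖slitFC p₀ s(x, x + cornerUnit 1)‖ ≤ 60 / Real.sqrt (1 + |(srcDX p₀ x : ℝ)| + |(srcDY p₀ x : ℝ)|) := by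
  rw [slitFC_north, slitFCV]
  refine (norm_kcVec_le _ _ _ _).trans ?_
  have h1 := (abs_re_le_norm _).trans (norm_slitFsh_le (srcDY p₀ x) (-srcDX p₀ x) (srcDY p₀ x))
  have h2 : |(-I * slitFsh (srcDY p₀ x) (-srcDX p₀ x) (srcDY p₀ x + 1)).re| ≤
      12 / Real.sqrt (1 + |(((-srcDX p₀ x : ℤ)) : ℝ)| + |(((srcDY p₀ x + 1 : ℤ)) : ℝ)|) := by
    refine (abs_re_le_norm _).trans ?_
    rw [norm_mul, norm_neg, Complex.norm_I, one_mul]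
    exact norm_slitFsh_le _ _ _
  push_cast at h1 h2
  rw [abs_neg] at h1 h2
  have h3 := (kesten_shift (srcDX p₀ x : ℝ) (srcDY p₀ x : ℝ)).2
  have hpos : 0 < 1 + |(srcDX p₀ x : ℝ)| + |(srcDY p₀ x : ℝ)| := by positivity
  have h4 : 12 / Real.sqrt (1 + |(srcDX p₀ x : ℝ)| + |(srcDY p₀ x : ℝ)|) ≤ 18 / Real.sqrt (1 + |(srcDX p₀ x : ℝ)| + |(srcDY p₀ x : ℝ)|) :=
    div_le_div_of_nonneg_right (by norm_num) (Real.sqrt_pos.2 hpos).le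
  calc |(slitFsh (srcDY p₀ x) (-srcDX p₀ x) (srcDY p₀ x)).re| + |(-I * slitFsh (srcDY p₀ x) (-srcDX p₀ x) (srcDY p₀ x + 1)).re|
      ≤ 18 / Real.sqrt (1 + |(srcDX p₀ x : ℝ)| + |(srcDY p₀ x : ℝ)|) + 18 / Real.sqrt (1 + |(srcDX p₀ x : ℝ)| + |(srcDY p₀ x : ℝ)|) :=
        add_le_add (h1.trans h4) (h2.trans h3)
    _ ≤ 60 / Real.sqrt (1 + |(srcDX p₀ x : ℝ)| + |(srcDY p₀ x : ℝ)|) := by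
        rw [← add_div]; exact div_le_div_of_nonneg_right (by norm_num) (Real.sqrt_pos.2 hpos).le

/-- `slitChi = ±1`. [folklore] -/
theorem slitChi_cases (p₀ : Site 2) (e : MedialVertex) : slitChi p₀ e = 1 ∨ slitChi p₀ e = -1 := by
  unfold slitChi slitChiH slitChiV
  split_ifs <;> simp

/-- The gauge does not change the norm: `‖slitFCg p₀ e‖ = ‖slitFC p₀ e‖`. [folklore] -/
theorem norm_slitFCg_eq (p₀ : Site 2) (e : MedialVertex) : ‖slitFCg p₀ e‖ = ‖slitFC p₀ e‖ := by
  rw [slitFCg, norm_mul, Complex.norm_real, Real.norm_eq_abs]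
  rcases slitChi_cases p₀ e with h | h <;> rw [h] <;> simp

/-- The offsets control the sup distance from the source plaquette:
`|y 0 - p₀ 0| ≤ |srcDX| + |srcDY|` and likewise for the ordinate. [folklore] -/
theorem abs_coord_sub_le_srcDX_add_srcDY (p₀ y : Site 2) (i : Fin 2) :
    |((y i - p₀ i : ℤ) : ℝ)| ≤ |(srcDX p₀ y : ℝ)| + |(srcDY p₀ y : ℝ)| := by
  have hX : (srcDX p₀ y : ℝ) = (y 0 - p₀ 0 : ℤ) + (y 1 - p₀ 1 : ℤ) := by simp [srcDX]
  have hY : (srcDY p₀ y : ℝ) = (y 1 - p₀ 1 : ℤ) - (y 0 - p₀ 0 : ℤ) := by simp [srcDY]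
  rw [hX, hY]
  set u : ℝ := ((y 0 - p₀ 0 : ℤ) : ℝ)
  set w : ℝ := ((y 1 - p₀ 1 : ℤ) : ℝ)
  fin_cases i
  · show |u| ≤ |u + w| + |w - u|
    have := abs_sub (u + w) (w - u)
    have e : u + w - (w - u) = 2 * u := by ring
    rw [e, abs_mul, abs_two] at this
    linarith [abs_nonneg (u + w), abs_nonneg (w - u), abs_nonneg u]
  · show |w| ≤ |u + w| + |w - u|
    have := abs_add_le (u + w) (w - u)
    have e : u + w + (w - u) = 2 * w := by ring
    rw [e, abs_mul, abs_two] at this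
    linarith [abs_nonneg (u + w), abs_nonneg (w - u), abs_nonneg w]

end Literature.Probability.LatticeModels
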